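import Literature.Analysis.FluidPDE.KochTataruPairing
import Literature.Analysis.FluidPDE.MildL3Restart
import Literature.Analysis.FluidPDE.MildL3RestartAveraging
import HarnessLib

/-!
# Kato fixed points at unit viscosity are duality-form mild solutions

Analysis/FluidPDE support file for the unit-viscosity discharge of Kato's weighted local existence
theorem in `L³(ℝ³)` (`kato_local_L3_unit`, `KatoLocalL3Scaling.lean`, whence `kato_local_L3`,
`MildL3Smooth.lean`; Kato 1984, Thm. 1; Lemarié-Rieusset 2016, Thm. 7.5). Kato's solution is a
pointwise fixed point `u(t) = e^{tΔ}u₀ - B(u,u)(t)` of the physical-space Duhamel map built on the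
Oseen–Koch–Tataru kernel (`B = kochTataruBilinear = oseenDuhamel 1 0`, `KochTataru.lean`,
`NSBoundedMildOseen.lean`), lying in Kato's weighted class `‖u(t)‖₃ ≤ M`, `√t ‖u(t)‖_∞ ≤ b`.
This file proves, independently of how the fixed point is constructed, the two facts that turn
such a fixed point into a solution in the tree's sense (Lemarié-Rieusset 2016, Thm. 6.1,
(6.12) ⇒ (6.11): Oseen/integral solutions are very weak solutions):

* `KatoL3.eKochTataruNorm_le_of_kato_bounds`: **Kato's class lies in Koch–Tataru's path space
  `X`** — a field with `√t‖u(t)‖_∞ ≤ b` and `‖u(t)‖₃ ≤ M` for all `t > 0` (dimension three) has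
  `‖u‖_X ≤ b + V₁^{1/6} M < ∞` (`V₁ = vol B(0,1)`; the Carleson part by Hölder on balls,
  `∫_{B(x,R)} |u|² ≤ |B_R|^{1/3} ‖u‖₃²`), so that the tested Duhamel identity and the weak
  divergence-freeness of `B(u,u)` proved in `KochTataruPairing.lean` apply to Kato solutions;
* `KatoL3.isWeaklyDivFree_heatExtension_of_memLp`: the free evolution of weakly divergence-free
  `Lᵖ` data is weakly divergence free (symmetry of the heat semigroup,
  `integral_inner_heatExtension_comm`, and the heat-kernel average of translated tests,
  `integral_heatKernel_mul_integral_inner_comp_sub`);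
* `KatoL3.isMildNSSolutionOn_of_fixedPoint`: **a fixed point is a mild solution in the duality
  form** `Fluid.IsMildNSSolutionOn (Ico 0 T) 1 0 u₀ u` — for `u₀ ∈ L³` weakly divergence free,
  `u` measurable on `(0,∞) × E` with `‖u‖_X < ∞`, `u(0) = u₀`, `u(t) ∈ L³` and
  `u(t) = e^{tΔ}u₀ - B(u,u)(t)` a.e. for `t ∈ (0, T)`: the datum term by the symmetry
  `∫⟪e^{tΔ}u₀, φ⟫ = ∫⟪u₀, e^{tΔ}φ⟫`, the nonlinear term by
  `integral_inner_kochTataruBilinear_eq_neg_intervalIntegral`, the solenoidality of the slices by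
  `isWeaklyDivFree_kochTataruBilinear`.

Everything is proved; no definitions (grouping namespace `KatoL3`).

## Mathlib / tree search

Tree: `eKochTataruNorm` (`CriticalRegularity.lean`), `kochTataruBilinear`,
`integral_inner_kochTataruBilinear_eq_neg_intervalIntegral`, `isWeaklyDivFree_kochTataruBilinear`,
`integrable_inner_kochTataruBilinear` (`KochTataruPairing.lean`), `integral_inner_heatExtension_comm`,
`integrable_inner_of_memLp_conj` (`MildL3Restart.lean`),
`integral_heatKernel_mul_integral_inner_comp_sub` (`MildL3RestartAveraging.lean`),
`IsWeaklyDivFree.sub`/`.congr_ae` (`KatoUniqueness.lean`, `SolenoidalL2Duality.lean`),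
`isWeaklyDivFree_heatExtension` (`KochTataruIntegralOfClass.lean`, for *tempered* data — the `Lᵖ`
version here avoids the tempering bookkeeping). Mathlib: `ENNReal.lintegral_mul_le_Lp_mul_Lq`,
`Measure.addHaar_ball_of_pos`, `iSup₂_le`.

## References

* T. Kato, Math. Z. 187 (1984) 471–480, Thm. 1, §2. [Kato1984]
* P. G. Lemarié-Rieusset, *The Navier–Stokes Problem in the 21st Century*, CRC Press 2016,
  doi:10.1201/b19556, Thm. 6.1 ((6.12) ⇒ (6.11)), Thm. 7.5. [LemarieRieusset2016]
* H. Koch, D. Tataru, Adv. Math. 157 (2001), §1 (the path space `X`). [KochTataruAdvMath2001]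
-/

noncomputable section

open MeasureTheory TopologicalSpace Set Function Filter Metric
open _root_.Topology
open scoped ENNReal NNReal RealInnerProductSpace InnerProductSpace

namespace Literature.Analysis.FluidPDE

namespace KatoL3

variable {E : Type*} [NormedAddCommGroup E] [InnerProductSpace ℝ E] [FiniteDimensional ℝ E]
  [MeasurableSpace E] [BorelSpace E]

/-! ### Kato's class lies in Koch–Tataru's path space -/

/-- **Hölder on balls**: `∫_{B(x,R)} ‖f‖² ≤ (vol B(x,R))^{1/3} ‖f‖_{L³}²` (exponents `3`, `3/2`).
[folklore] -/
theorem lintegral_ball_enorm_sq_le {f : E → E} (hf : AEStronglyMeasurable f volume) (x : E) (R : ℝ) :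
    ∫⁻ y in ball x R, ‖f y‖ₑ ^ 2 ≤
      (volume (ball x R)) ^ (1 / 3 : ℝ) * eLpNorm f 3 volume ^ 2 := by
  have hpq : (3 : ℝ).HolderConjugate (3 / 2) := ⟨by norm_num, by norm_num, by norm_num⟩
  have h1 : AEMeasurable ((ball x R).indicator fun _ => (1 : ℝ≥0∞)) (volume : Measure E) :=
    (measurable_const.indicator measurableSet_ball).aemeasurable
  have h2 : AEMeasurable (fun y => ‖f y‖ₑ ^ 2) (volume : Measure E) := hf.enorm.pow_const _
  have hH := ENNReal.lintegral_mul_le_Lp_mul_Lq volume hpq h1 h2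
  have hlhs : ∫⁻ y in ball x R, ‖f y‖ₑ ^ 2 =
      ∫⁻ y, ((ball x R).indicator (fun _ => (1 : ℝ≥0∞)) * fun y => ‖f y‖ₑ ^ 2) y := by
    rw [← lintegral_indicator measurableSet_ball]
    refine lintegral_congr fun y => ?_
    by_cases hy : y ∈ ball x R <;> simp [hy]
  rw [hlhs]
  refine hH.trans (le_of_eq ?_)
  congr 1
  · rw [show (fun a => (ball x R).indicator (fun _ => (1 : ℝ≥0∞)) a ^ (3 : ℝ)) =
        (ball x R).indicator (fun _ => (1 : ℝ≥0∞)) from ?_, lintegral_indicator_const measurableSet_ball,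
      one_mul]
    funext a
    by_cases ha : a ∈ ball x R <;> simp [ha]
  · have h3 : (3 : ℝ≥0∞) ≠ 0 := by norm_num
    rw [eLpNorm_eq_lintegral_rpow_enorm_toReal h3 (by norm_num), ENNReal.toReal_ofNat]
    have hin : ∀ a : E, (‖f a‖ₑ ^ 2) ^ (3 / 2 : ℝ) = ‖f a‖ₑ ^ (3 : ℝ) := fun a => by
      rw [← ENNReal.rpow_natCast, ← ENNReal.rpow_mul]
      norm_num
    simp_rw [hin]
    rw [← ENNReal.rpow_natCast ((∫⁻ x, ‖f x‖ₑ ^ (3 : ℝ)) ^ (1 / 3 : ℝ)) 2, ← ENNReal.rpow_mul]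
    norm_num

/-- **Kato's weighted class lies in Koch–Tataru's path space `X`** (dimension three): if
`√t ‖u(t)‖_{L^∞} ≤ b` and `‖u(t)‖_{L³} ≤ M` for all `t > 0` (with measurable slices), then
`‖u‖_X ≤ b + (vol B(0,1))^{1/6} M`; in particular `‖u‖_X < ∞`. The `L^∞` part is the
hypothesis; for the Carleson part,
`R⁻³ ∫₀^{R²} ∫_{B(x,R)} |u|² ≤ R⁻³ · R² · (V₁R³)^{1/3} M² = V₁^{1/3} M²` (Koch–Tataru 2001, §1;
Kato's class `L^∞_t L³_x` is scale invariant like `X`). [cite: KochTataruAdvMath2001, §1 (the path space X)] -/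
theorem eKochTataruNorm_le_of_kato_bounds (hE : Module.finrank ℝ E = 3) {u : ℝ → E → E}
    (hmeas : ∀ t, AEStronglyMeasurable (u t) volume) {b M : ℝ}
    (hinf : ∀ t, 0 < t → eLpNorm (u t) ∞ volume ≤ ENNReal.ofReal (b * t ^ (-(1 / 2 : ℝ))))
    (h3 : ∀ t, 0 < t → eLpNorm (u t) 3 volume ≤ ENNReal.ofReal M) :
    eKochTataruNorm u ≤ ENNReal.ofReal b +
      (volume (ball (0 : E) 1)) ^ (1 / 6 : ℝ) * ENNReal.ofReal M := by
  unfold eKochTataruNorm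
  refine add_le_add ?_ ?_
  · refine iSup₂_le fun t ht => ?_
    calc ENNReal.ofReal (Real.sqrt t) * eLpNorm (u t) ⊤ volume
        ≤ ENNReal.ofReal (Real.sqrt t) * ENNReal.ofReal (b * t ^ (-(1 / 2 : ℝ))) :=
          mul_le_mul' le_rfl (hinf t ht)
      _ = ENNReal.ofReal b := by
          rw [← ENNReal.ofReal_mul (Real.sqrt_nonneg _)]
          congr 1
          rw [Real.sqrt_eq_rpow, mul_left_comm, ← Real.rpow_add ht]
          norm_num
  · refine iSup_le fun x => iSup₂_le fun R hR => ?_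
    rw [hE]
    set V₁ : ℝ≥0∞ := volume (ball (0 : E) 1) with hV₁
    -- the inner space integral on each slice
    have hslice : ∀ t, 0 < t → ∫⁻ y in ball x R, ‖u t y‖ₑ ^ 2 ≤
        (ENNReal.ofReal (R ^ 3) * V₁) ^ (1 / 3 : ℝ) * ENNReal.ofReal M ^ 2 := by
      intro t ht
      refine (lintegral_ball_enorm_sq_le (hmeas t) x R).trans ?_
      rw [Measure.addHaar_ball_of_pos volume x hR, hE]
      gcongr
      exact h3 t ht
    -- integrate in time over `(0, R²)`
    have htime : ∫⁻ t in Ioo 0 (R ^ 2), ∫⁻ y in ball x R, ‖u t y‖ₑ ^ 2 ≤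
        ENNReal.ofReal (R ^ 2) * ((ENNReal.ofReal (R ^ 3) * V₁) ^ (1 / 3 : ℝ) * ENNReal.ofReal M ^ 2) := by
      calc ∫⁻ t in Ioo 0 (R ^ 2), ∫⁻ y in ball x R, ‖u t y‖ₑ ^ 2
          ≤ ∫⁻ _ in Ioo 0 (R ^ 2), (ENNReal.ofReal (R ^ 3) * V₁) ^ (1 / 3 : ℝ) * ENNReal.ofReal M ^ 2 :=
            setLIntegral_mono' measurableSet_Ioo fun t ht => hslice t ht.1
        _ = _ := by
            rw [setLIntegral_const, Real.volume_Ioo, sub_zero, mul_comm]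
    -- assemble: `(R³)⁻¹ R² (R³ V₁)^{1/3} M² = V₁^{1/3} M²`
    have hR3 : ENNReal.ofReal (R ^ 3) ≠ 0 := by
      rw [ENNReal.ofReal_ne_zero_iff]; positivity
    have hkey : (ENNReal.ofReal (R ^ 3))⁻¹ * (ENNReal.ofReal (R ^ 2) *
        ((ENNReal.ofReal (R ^ 3) * V₁) ^ (1 / 3 : ℝ) * ENNReal.ofReal M ^ 2)) =
        V₁ ^ (1 / 3 : ℝ) * ENNReal.ofReal M ^ 2 := by
      rw [ENNReal.mul_rpow_of_nonneg _ _ (by norm_num : (0 : ℝ) ≤ 1 / 3),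
        ENNReal.ofReal_rpow_of_nonneg (by positivity) (by norm_num), ← Real.rpow_natCast,
        ← Real.rpow_mul hR.le]
      norm_num
      have hRR : (ENNReal.ofReal (R ^ 3))⁻¹ * (ENNReal.ofReal (R ^ 2) * ENNReal.ofReal R) = 1 := by
        rw [← ENNReal.ofReal_mul (by positivity), show R ^ 2 * R = R ^ 3 by ring,
          ENNReal.inv_mul_cancel hR3 ENNReal.ofReal_ne_top]
      calc (ENNReal.ofReal (R ^ 3))⁻¹ * (ENNReal.ofReal (R ^ 2) *
            (ENNReal.ofReal R * V₁ ^ (1 / 3 : ℝ) * ENNReal.ofReal M ^ 2))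
          = (ENNReal.ofReal (R ^ 3))⁻¹ * (ENNReal.ofReal (R ^ 2) * ENNReal.ofReal R) *
              (V₁ ^ (1 / 3 : ℝ) * ENNReal.ofReal M ^ 2) := by ring
        _ = V₁ ^ (1 / 3 : ℝ) * ENNReal.ofReal M ^ 2 := by rw [hRR, one_mul]
    calc ((ENNReal.ofReal (R ^ 3))⁻¹ * ∫⁻ t in Ioo 0 (R ^ 2), ∫⁻ y in ball x R, ‖u t y‖ₑ ^ 2) ^ (1 / 2 : ℝ)
        ≤ ((ENNReal.ofReal (R ^ 3))⁻¹ * (ENNReal.ofReal (R ^ 2) *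
            ((ENNReal.ofReal (R ^ 3) * V₁) ^ (1 / 3 : ℝ) * ENNReal.ofReal M ^ 2))) ^ (1 / 2 : ℝ) := by
          gcongr
      _ = (V₁ ^ (1 / 3 : ℝ) * ENNReal.ofReal M ^ 2) ^ (1 / 2 : ℝ) := by rw [hkey]
      _ = V₁ ^ (1 / 6 : ℝ) * ENNReal.ofReal M := by
          rw [ENNReal.mul_rpow_of_nonneg _ _ (by norm_num : (0 : ℝ) ≤ 1 / 2), ← ENNReal.rpow_mul,
            ← ENNReal.rpow_natCast, ← ENNReal.rpow_mul]
          norm_num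

/-- Finite form of `eKochTataruNorm_le_of_kato_bounds`: `‖u‖_X < ∞` for Kato-class fields.
[cite: KochTataruAdvMath2001, §1 (the path space X)] -/
theorem eKochTataruNorm_lt_top_of_kato_bounds (hE : Module.finrank ℝ E = 3) {u : ℝ → E → E}
    (hmeas : ∀ t, AEStronglyMeasurable (u t) volume) {b M : ℝ}
    (hinf : ∀ t, 0 < t → eLpNorm (u t) ∞ volume ≤ ENNReal.ofReal (b * t ^ (-(1 / 2 : ℝ))))
    (h3 : ∀ t, 0 < t → eLpNorm (u t) 3 volume ≤ ENNReal.ofReal M) :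
    eKochTataruNorm u < ∞ := by
  refine (eKochTataruNorm_le_of_kato_bounds hE hmeas hinf h3).trans_lt ?_
  refine ENNReal.add_lt_top.2 ⟨ENNReal.ofReal_lt_top, ENNReal.mul_lt_top ?_ ENNReal.ofReal_lt_top⟩
  exact ENNReal.rpow_lt_top_of_nonneg (by norm_num) (measure_ball_lt_top).ne

/-! ### The free evolution of solenoidal `Lᵖ` data is solenoidal -/

/-- **The free evolution of weakly divergence-free `Lᵖ` data is weakly divergence free**
(Lemarié-Rieusset 2016, Cor. 6.2: `div e^{tΔ}u₀ = e^{tΔ} div u₀ = 0`): for `θ ∈ C_c^∞`,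
`∫⟪e^{tΔ}u₀, ∇θ⟫ = ∫⟪u₀, e^{tΔ}∇θ⟫ = ∫ K_t(y) (∫⟪u₀, ∇θ(· - y)⟫) dy = 0`, the inner pairings
vanishing because `∇θ(· - y) = ∇(θ(· - y))` is the gradient of a test function (symmetry of the
heat semigroup and the heat-kernel average of translated pairings). [cite: LemarieRieusset2016, Cor. 6.2] -/
theorem isWeaklyDivFree_heatExtension_of_memLp {u₀ : E → E} {p q : ℝ≥0∞} [hpq : p.HolderConjugate q]
    (hu₀ : MemLp u₀ p volume) (hdiv : IsWeaklyDivFree u₀) {t : ℝ} (ht : 0 < t) :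
    IsWeaklyDivFree (fun x => UnboundedOperators.heatExtension u₀ t x) := by
  haveI : CompleteSpace E := FiniteDimensional.complete ℝ E
  intro θ hθ
  have hθ1 : ContDiff ℝ 1 θ := hθ.contDiff.of_le (by exact_mod_cast le_top)
  have hgc : Continuous (gradient θ) := continuous_gradient_of_contDiff hθ1
  have hgs : HasCompactSupport (gradient θ) :=
    (hθ.hasCompactSupport.fderiv (𝕜 := ℝ)).comp_left (g := (InnerProductSpace.toDual ℝ E).symm)
      (map_zero _)
  have hgq : MemLp (gradient θ) q volume := hgc.memLp_of_hasCompactSupport hgs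
  -- symmetry: `∫⟪e^{tΔ}u₀, ∇θ⟫ = ∫⟪u₀, e^{tΔ}∇θ⟫`
  have hsymm := integral_inner_heatExtension_comm hu₀ hgq ht
  change ∫ x, ⟪UnboundedOperators.heatExtension u₀ t x, gradient θ x⟫ = 0
  rw [← hsymm]
  -- average of translated pairings, each zero
  obtain ⟨-, havg⟩ := integral_heatKernel_mul_integral_inner_comp_sub hu₀ hgq ht
  rw [← havg]
  have hzero : ∀ y : E, ∫ x, ⟪u₀ x, gradient θ (x - y)⟫ = 0 := by
    intro y
    have hθy : FunctionSpaces.IsTestFunctionOn (⊤ : Opens E) (fun x => θ (x + -y)) :=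
      hθ.comp_add_right_top (-y)
    have h := hdiv _ hθy
    have hgrad : ∀ x, gradient (fun x => θ (x + -y)) x = gradient θ (x - y) := by
      intro x
      simp only [gradient, fderiv_comp_add_right, sub_eq_add_neg]
    simp only [hgrad] at h
    exact h
  have hfun : (fun y : E => UnboundedOperators.heatKernel t y * ∫ x, ⟪u₀ x, gradient θ (x - y)⟫) =
      fun _ => 0 := funext fun y => by rw [hzero y, mul_zero]
  rw [hfun, integral_zero]

/-! ### Fixed points are mild solutions in the duality form -/

/-- **A Kato fixed point is a mild solution in the duality form** (Lemarié-Rieusset 2016,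
Thm. 6.1, (6.12) ⇒ (6.11): a solution of the integral (Oseen) equation is a very weak solution;
Koch–Tataru 2001, §3: "we can rewrite the Navier–Stokes equation as (11)"). Let `u₀ ∈ L³` be
weakly divergence free and let `u` be measurable on `(0, ∞) × E` with finite Koch–Tataru norm
(e.g. a Kato-class field extended by zero, `eKochTataruNorm_lt_top_of_kato_bounds`), `u(0) = u₀`,
`u(t) ∈ L³` and `u(t) = e^{tΔ}u₀ - B(u,u)(t)` a.e. for every `t ∈ (0, T)`
(`B = kochTataruBilinear`, unit viscosity). Then `u` is an unforced mild solution on `[0, T)` from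
`u₀` with viscosity `1` in the tree's duality form. Proof: against a divergence-free test `φ`,
`∫⟪e^{tΔ}u₀, φ⟫ = ∫⟪u₀, e^{tΔ}φ⟫` (`integral_inner_heatExtension_comm`) and
`∫⟪B(u,u)(t), φ⟫ = -∫₀ᵗ∫⟪u, (u·∇)e^{(t-τ)Δ}φ⟫` (`integral_inner_kochTataruBilinear_eq_neg_intervalIntegral`);
the slices are weakly divergence free as differences of `e^{tΔ}u₀`
(`isWeaklyDivFree_heatExtension_of_memLp`) and `B(u,u)(t)` (`isWeaklyDivFree_kochTataruBilinear`).
[cite: LemarieRieusset2016, Thm. 6.1 ((6.12) ⇒ (6.11))] -/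
theorem isMildNSSolutionOn_of_fixedPoint {u₀ : E → E} (hu₀ : MemLp u₀ 3 volume)
    (hdiv : IsWeaklyDivFree u₀) {u : ℝ → E → E} {T : ℝ} (hu0 : u 0 = u₀)
    (hmeas : AEStronglyMeasurable (uncurry u)
      ((volume : Measure (ℝ × E)).restrict (Ioi 0 ×ˢ univ)))
    (hX : eKochTataruNorm u < ∞) (h3 : ∀ t ∈ Ioo 0 T, MemLp (u t) 3 volume)
    (hfix : ∀ t ∈ Ioo 0 T, u t =ᵐ[volume]
      fun x => UnboundedOperators.heatExtension u₀ t x - kochTataruBilinear u u t x) :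
    IsMildNSSolutionOn (Ico 0 T) 1 0 u₀ u := by
  haveI hHC : (3 : ℝ≥0∞).HolderConjugate (ENNReal.conjExponent 3) := .conjExponent (by norm_num)
  have hq1 : 1 ≤ ENNReal.conjExponent 3 := ENNReal.HolderConjugate.one_le (ENNReal.conjExponent 3) 3
  have h31 : (1 : ℝ≥0∞) ≤ 3 := by norm_num
  -- the free evolution at positive times
  have hU3 : ∀ {t : ℝ}, 0 < t → MemLp (fun x => UnboundedOperators.heatExtension u₀ t x) 3 volume :=
    fun ht => UnboundedOperators.memLp_heatExtension_holds hu₀ h31 ht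
  -- `B(u,u)(t) ∈ L³` for `t ∈ (0, T)`: it is a.e. `e^{tΔ}u₀ - u(t)`
  have hB3 : ∀ {t : ℝ}, t ∈ Ioo 0 T → MemLp (kochTataruBilinear u u t) 3 volume := by
    intro t ht
    have hae : kochTataruBilinear u u t =ᵐ[volume]
        fun x => UnboundedOperators.heatExtension u₀ t x - u t x := by
      filter_upwards [hfix t ht] with x hx
      rw [hx]
      abel
    exact ((hU3 ht.1).sub (h3 t ht)).ae_eq hae.symm
  refine ⟨fun t ht => ?_, fun t ht => ?_⟩
  · -- weak divergence-freeness of the slices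
    rcases ht.1.eq_or_lt with h | hpos
    · rw [← h, hu0]
      exact hdiv
    · have htT : t ∈ Ioo 0 T := ⟨hpos, ht.2⟩
      have hUdiv := isWeaklyDivFree_heatExtension_of_memLp (q := ENNReal.conjExponent 3) hu₀ hdiv hpos
      have hBdiv := isWeaklyDivFree_kochTataruBilinear hmeas hmeas hX hX t
      exact (hUdiv.sub h31 hBdiv (hU3 hpos) (hB3 htT)).congr_ae (hfix t htT).symm
  · -- the duality identity from the datum
    rcases ht.1.eq_or_lt with h | hpos
    · rw [← h]
      refine isMildNSSolutionFrom_zero_iff.2 fun φ _ _ => ?_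
      rw [hu0]
    · have htT : t ∈ Ioo 0 T := ⟨hpos, ht.2⟩
      intro φ hφ hφdiv
      simp only [Pi.zero_apply, inner_zero_left, integral_zero, intervalIntegral.integral_zero,
        add_zero]
      have hφq : MemLp φ (ENNReal.conjExponent 3) volume :=
        hφ.contDiff.continuous.memLp_of_hasCompactSupport hφ.hasCompactSupport
      -- split `u(t) = U(t) - B(t)` inside the pairing
      have iU : Integrable (fun x => ⟪UnboundedOperators.heatExtension u₀ t x, φ x⟫) volume :=
        integrable_inner_of_memLp_conj (hU3 hpos) hφq
      have iB : Integrable (fun x => ⟪kochTataruBilinear u u t x, φ x⟫) volume :=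
        integrable_inner_kochTataruBilinear hmeas hmeas hX hX hpos hφ.contDiff.continuous
          hφ.hasCompactSupport
      have hsplit : ∫ x, ⟪u t x, φ x⟫ = (∫ x, ⟪UnboundedOperators.heatExtension u₀ t x, φ x⟫) -
          ∫ x, ⟪kochTataruBilinear u u t x, φ x⟫ := by
        rw [← integral_sub iU iB]
        refine integral_congr_ae ?_
        filter_upwards [hfix t htT] with x hx
        rw [hx, inner_sub_left]
      -- the datum term by symmetry, the nonlinear term by the tested Duhamel identity
      have hdat : ∫ x, ⟪UnboundedOperators.heatExtension u₀ t x, φ x⟫ =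
          ∫ x, ⟪u₀ x, heatTest 1 φ t x⟫ := by
        rw [heatTest_of_pos one_pos hpos, one_mul]
        exact (integral_inner_heatExtension_comm hu₀ hφq hpos).symm
      have hnl := integral_inner_kochTataruBilinear_eq_neg_intervalIntegral hmeas hX hpos hφ hφdiv
      rw [hsplit, hdat, hnl]
      ring

end KatoL3

end Literature.Analysis.FluidPDE
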